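/-
Origin: expansion seat `planner-pub-hodgecm-mc-period-2-g4-0`, handover #1 2026-08-19T00:29Z md5 cb2e6dd72a1f04443b829a3ed64ab2ba (v2 RE-POST, replaces 00:08Z c9a92d3a96a41881b2c5560b94c85890: level-indexed Kc/κ/τ/η₁/hη per theta-3-g3 (F2) 00:16:02Z; NEW additive leaf, 198 l., node E data binders 6–7 Theta/d12/d34 = VACANCY (v21) pin, model2-g4 (Z′) 23:57:29Z + glue-1-g3 00:02:16Z WELCOME; imports installed r32 modules HodgeCM.Automorphic.SignRecipeEndStateAllChars +  (`HOME/mc/pub-hodgecm-mc-period-2/g4/pkg/HodgeCM/Model/ThetaSideInstance.lean`, md5 cb2e6dd7, 198 lines);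
landed by the gen-9 packager (p-g9) in gate run 33 as `HodgeCM/Model/ThetaSideInstance.lean` (verbatim).
-/
/-
Copyright (c) 2026. Released under Apache 2.0 license as described in the file LICENSE.
Cell pub-hodgecm, MODEL layer (construction prover mc-period-2, gen 4), E data binders 6–7 of `MODEL-DAG.md` §0
(`Theta`, `d12 d34` of `Model.thetaModelOf`, `HodgeCM/Model/E2Instance.lean`).
-/
import Summits.HodgeConjecture.HodgeCM.Automorphic.SignRecipeEndStateAllChars_2
import Literature.NumberTheory.Automorphic.ThetaClassSupply

/-!
# Theta-side instance: the VALUES of the E data binders `Theta`, `d12`, `d34`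

The assembler `Model.thetaModelOf hHD hI h₁ h₂ h₃ h emb cover wm Theta d12 d34` (`Model/E2Instance`) takes the theta
one-form sets and the torus-side data as DATA binders

* `Theta : ∀ {L} {ι₁} (V : HermSpace3 L ι₁), SeesawCtx L → Fin 4 → ∀ Γ : Level V, Set (U.CohC (U.pms L ι₁ V Γ) 1)`,
* `d12 d34 : ∀ {L : CMField}, SeesawCtx L → SideData L`.

This module PINS their values BY NAME, as functions of the inputs the producing lanes hand over, so that E binds those
inputs instead and every consumer reads the SAME definition:

* `Model.thetaOf U I V c i Γ := WeightForms.thetaClasses (I V c).ιinf ((I V c).D Γ) ((I V c).Θ i Γ)` — the theta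
  classes (tree `Literature.NumberTheory.Automorphic.ThetaClassSupply`, node W6b-2: the `(1,0)`-classes whose
  harmonic pullback is the archimedean restriction of an adelic form of the given space, holomorphic after
  restriction) of the space `Θ i Γ` of adelic theta forms of type index `i` at level `Γ`, through the class-map
  datum `D Γ` of `Γ\𝔹²` INTO THE MODEL UNIVERSE (node D3-geom) — over ONE record `Model.ThetaClassInput U V c` per
  context `(V, c)` collecting exactly the data `thetaClasses` is stated over: the adelic group `GU`, the weight
  module `W` and the archimedean component (`ιinf : G₁ →* GU`, `κ₁ : K₁ →* G₁`, `τ₁`), and PER LEVEL `Γ : Level V`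
  (interface finding (F2) of the theta supply lane: the `K`-type index group must contain the finite level) the
  `K`-type bookkeeping (`κ Γ : Kc Γ →* GU`, weight `τ Γ` on `W`, `η₁ Γ : K₁ →* Kc Γ` with `IsWeightMatched`), the
  adelic level `ΓU Γ`, the arithmetic group `Δ Γ` with `IsLevelCorrected`, the class-map datum `D Γ`, and the four
  theta-form spaces `Θ i Γ ≤ weightForms (ΓU Γ) (κ Γ) (τ Γ)` (values: `ThetaKernelDatum.thetaForms …` of the Weil
  theta model `wm V c`, node W6b-1 / J3).  With this value the
  field `ClassSupplyData.theta_sub` of `Model/SupplyDischarge` («`thetaClasses ιinf D (thetaForms 𝓙 𝓕) ⊆ T.Theta V c k Γ₀`»)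
  is an inclusion between theta-class sets of the SAME shape (equality when the supply data are cut from `I`).
* `Model.d12Of μ c := (⟨-μ c 0, -μ c 1⟩ : SideArchType L).side`, `Model.d34Of μ c := (⟨-μ c 2, -μ c 3⟩ : SideArchType L).side`
  — the recipe of record of node W6b-3 (mc-period-2-g2, `HANDOFF.md` §«W6b-3 values of record»; tree
  `Literature.NumberTheory.Automorphic.UnitaryLineArchExponents`): the archimedean type of the side `W₁ ⊕ W₂`
  (resp. `W₃ ⊕ W₄`) is MINUS the archimedean exponents `μ_k c : InfinitePlace L → ℤ` of the unitary line characters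
  `ν_k` of the context (`k = 1,2`, resp. `3,4`; here `μ c k`, `k : Fin 4`, is `μ_{k+1} c`), with EVERY character of
  that type allowed (`SideArchType.side`; the all-characters END STATE of `Automorphic/SignRecipeEndStateAllChars`).
  The exponents `μ` stay a binder of E until the W2-∞ lane hands the term (N-W∞-c).

KERNEL, definitions + `rfl`/one-line lemmas only (`thetaOf_eq`, `thetaOf_subset_H10`, `zero_mem_thetaOf`,
`thetaClasses_subset_thetaOf`, `d12Of_m₁/m₂`, `d34Of_m₁/m₂`, `d12Of_allowed`, `d34Of_allowed`, `d12Of_arch_side`, `d34Of_arch_side`).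
ABSOLUTE RULE honoured: nothing is asserted or cited; `ThetaClassInput` is a DATA record whose two `Prop` fields
(`hη`, `hΔ`) are the tree's hypotheses of `WeightForms.restrictHom`, to be supplied by the producers as proofs.
0 proof holes, 0 new axioms.
-/

set_option autoImplicit false

noncomputable section

open NumberField
open Literature.NumberTheory.Automorphic
open Literature.NumberTheory.Automorphic.WeightForms (ClassMapDatum thetaClasses IsLevelCorrected IsWeightMatched)

namespace HodgeCM

namespace Model

open HodgeCM.Universe (SideData SideArchType)

/-! ## 1. The torus-side data from the archimedean exponents (binder 7: `d12`, `d34`) -/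

section Side

variable (μ : ∀ {L : CMField}, SeesawCtx L → Fin 4 → InfinitePlace L → ℤ)

/-- **`d12` of record**: the side `W₁ ⊕ W₂` has archimedean type `(-μ₁ c, -μ₂ c)` and every character of that
type allowed. -/
def d12Of {L : CMField} (c : SeesawCtx L) : SideData L :=
  (⟨-μ c 0, -μ c 1⟩ : SideArchType L).side

/-- **`d34` of record**: the side `W₃ ⊕ W₄` has archimedean type `(-μ₃ c, -μ₄ c)` and every character of that
type allowed. -/
def d34Of {L : CMField} (c : SeesawCtx L) : SideData L :=
  (⟨-μ c 2, -μ c 3⟩ : SideArchType L).side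

variable {L : CMField} (c : SeesawCtx L)

/-- (Ported verbatim from the HodgeCMPerL package; no docstring in the source.) -/
@[simp] theorem d12Of_m₁ : (d12Of μ c).m₁ = -μ c 0 := rfl
/-- (Ported verbatim from the HodgeCMPerL package; no docstring in the source.) -/
@[simp] theorem d12Of_m₂ : (d12Of μ c).m₂ = -μ c 1 := rfl
/-- (Ported verbatim from the HodgeCMPerL package; no docstring in the source.) -/
@[simp] theorem d34Of_m₁ : (d34Of μ c).m₁ = -μ c 2 := rfl
/-- (Ported verbatim from the HodgeCMPerL package; no docstring in the source.) -/
@[simp] theorem d34Of_m₂ : (d34Of μ c).m₂ = -μ c 3 := rfl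

/-- Every character of the type is allowed on the side `W₁ ⊕ W₂`. -/
theorem d12Of_allowed (χ : ↥(SeesawTorus.allowedChars (L : Type) (d12Of μ c).m₁ (d12Of μ c).m₂)) :
    (d12Of μ c).allowed χ := trivial

/-- Every character of the type is allowed on the side `W₃ ⊕ W₄`. -/
theorem d34Of_allowed (χ : ↥(SeesawTorus.allowedChars (L : Type) (d34Of μ c).m₁ (d34Of μ c).m₂)) :
    (d34Of μ c).allowed χ := trivial

/-- `d12Of` is an all-characters side: it is the `side` of its own archimedean type. -/
theorem d12Of_arch_side : (d12Of μ c).arch.side = d12Of μ c := rfl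

/-- `d34Of` is an all-characters side. -/
theorem d34Of_arch_side : (d34Of μ c).arch.side = d34Of μ c := rfl

/-- (Ported verbatim from the HodgeCMPerL package; no docstring in the source.) -/
theorem d12Of_arch : (d12Of μ c).arch = ⟨-μ c 0, -μ c 1⟩ := rfl
/-- (Ported verbatim from the HodgeCMPerL package; no docstring in the source.) -/
theorem d34Of_arch : (d34Of μ c).arch = ⟨-μ c 2, -μ c 3⟩ := rfl

end Side

/-! ## 2. The theta one-form sets as theta classes (binder 6: `Theta`) -/

/-- **The input of the theta sets in the context `(V, c)`**: the data over which the tree's `WeightForms.thetaClasses`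
is stated, at every level `Γ : Level V` of the surface.  DATA record; the two `Prop`-valued fields are the hypotheses of
the tree's archimedean restriction `WeightForms.restrictHom`.  LEVEL-INDEXED (interface finding (F2) of the theta
supply lane, mc-theta-3-g3 2026-08-19T00:16Z): the ambient adelic group `GU`, the weight module `W` and the archimedean
data `G₁ K₁ ιinf κ₁ τ₁` are fixed in the context, while the `K`-type index group `Kc Γ` (it must contain the finite
level), its map `κ Γ`, the weight `τ Γ`, the matching `η₁ Γ` / `hη Γ`, the adelic level `ΓU Γ`, the arithmetic group
`Δ Γ`, the level correction `hΔ Γ`, the class-map datum `D Γ` and the theta-form spaces `Θ i Γ` all depend on the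
level `Γ` — so that `Θ_i(Γ)` can host theta forms of every level (and their Hecke translates), not only of the coarsest. -/
structure ThetaClassInput (U : Universe) {L : CMField} {ι₁ : L →+* ℂ} (V : HermSpace3 L ι₁) (c : SeesawCtx L) :
    Type 1 where
  /-- the adelic group `G_U(𝔸)` of the surface -/
  GU : Type
  [instGU : Group GU]
  /-- the weight module of the one-forms -/
  W : Type
  [instW : AddCommGroup W]
  [instWm : Module ℂ W]
  /-- the archimedean component group `G₁ = G_U(ℝ)` -/
  G₁ : Type
  [instG₁ : Group G₁]
  /-- its maximal compact `K₁` -/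
  K₁ : Type
  [instK₁ : Group K₁]
  /-- the inclusion of the archimedean component -/
  ιinf : G₁ →* GU
  /-- `K₁ → G₁` -/
  κ₁ : K₁ →* G₁
  /-- the classical weight -/
  τ₁ : Representation ℂ K₁ W
  /-- index group of the `K`-types at level `Γ` (`K_f(Γ) × K_∞`) -/
  Kc : Level V → Type
  [instKc : ∀ Γ : Level V, Group (Kc Γ)]
  /-- its map to `G_U(𝔸)`, per level -/
  κ : ∀ Γ : Level V, Kc Γ →* GU
  /-- the weight, per level -/
  τ : ∀ Γ : Level V, Representation ℂ (Kc Γ) W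
  /-- `K₁ → Kc Γ` over `ιinf`, per level -/
  η₁ : ∀ Γ : Level V, K₁ →* Kc Γ
  /-- weight matching (tree `WeightForms.IsWeightMatched`), per level -/
  hη : ∀ Γ : Level V, IsWeightMatched (κ Γ) (τ Γ) ιinf κ₁ τ₁ (η₁ Γ)
  /-- the adelic level attached to the level `Γ` of the surface -/
  ΓU : Level V → Subgroup GU
  /-- the arithmetic group of the level `Γ` inside `G₁` -/
  Δ : Level V → Subgroup G₁
  /-- level correction (tree `WeightForms.IsLevelCorrected`), per level -/
  hΔ : ∀ Γ : Level V, IsLevelCorrected (ΓU Γ) (κ Γ) (τ Γ) ιinf (Δ Γ)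
  /-- the class-map datum of `Γ\𝔹²` INTO the model universe (node D3-geom), per level -/
  D : ∀ Γ : Level V, ClassMapDatum ιinf (hΔ Γ) (hη Γ) (U.CohC (U.pms L ι₁ V Γ) 1)
  /-- the adelic theta forms of type index `i` at level `Γ` (node W6b-1 / J3: `ThetaKernelDatum.thetaForms …`) -/
  Θ : Fin 4 → ∀ Γ : Level V, Submodule ℂ (weightForms (ΓU Γ) (κ Γ) (τ Γ))

attribute [instance] ThetaClassInput.instGU ThetaClassInput.instKc ThetaClassInput.instW ThetaClassInput.instWm
  ThetaClassInput.instG₁ ThetaClassInput.instK₁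

section Theta

variable (U : Universe)
  (I : ∀ {L : CMField} {ι₁ : L →+* ℂ} (V : HermSpace3 L ι₁) (c : SeesawCtx L), ThetaClassInput U V c)

/-- **`Theta` of record**: `Θ_i(Γ)` = the theta classes of the adelic theta forms of type index `i` at level `Γ`,
through the class map of `Γ\𝔹²` (tree `WeightForms.thetaClasses`). -/
def thetaOf {L : CMField} {ι₁ : L →+* ℂ} (V : HermSpace3 L ι₁) (c : SeesawCtx L) (i : Fin 4) (Γ : Level V) :
    Set (U.CohC (U.pms L ι₁ V Γ) 1) :=
  thetaClasses (I V c).ιinf ((I V c).D Γ) ((I V c).Θ i Γ)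

variable {L : CMField} {ι₁ : L →+* ℂ} (V : HermSpace3 L ι₁) (c : SeesawCtx L) (i : Fin 4) (Γ : Level V)

/-- The pin, as an equation (definitional). -/
theorem thetaOf_eq : thetaOf U I V c i Γ = thetaClasses (I V c).ιinf ((I V c).D Γ) ((I V c).Θ i Γ) := rfl

/-- Theta classes are `(1,0)`-classes of the class-map datum. -/
theorem thetaOf_subset_H10 : thetaOf U I V c i Γ ⊆ ((I V c).D Γ).H10 :=
  WeightForms.thetaClasses_subset (I V c).ιinf ((I V c).D Γ) ((I V c).Θ i Γ)

/-- The zero class is a theta class. -/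
theorem zero_mem_thetaOf : (0 : U.CohC (U.pms L ι₁ V Γ) 1) ∈ thetaOf U I V c i Γ :=
  WeightForms.zero_mem_thetaClasses (I V c).ιinf ((I V c).D Γ) ((I V c).Θ i Γ)

/-- A theta-class set of a SMALLER space of adelic forms through the SAME class-map datum lies in `Θ_i(Γ)`
(the shape of `ClassSupplyData.theta_sub`). -/
theorem thetaClasses_subset_thetaOf {Θ' : Submodule ℂ (weightForms ((I V c).ΓU Γ) ((I V c).κ Γ) ((I V c).τ Γ))}
    (h : Θ' ≤ (I V c).Θ i Γ) : thetaClasses (I V c).ιinf ((I V c).D Γ) Θ' ⊆ thetaOf U I V c i Γ :=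
  WeightForms.thetaClasses_mono (I V c).ιinf ((I V c).D Γ) h

end Theta

end Model

end HodgeCM

end
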